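import Summits.KontsevichZagierPeriods.Zeta5Search.Barrier.ConeGammaCuspPeriodLocal

/-!
# ζ(5) search — BARRIER: THE OFF-CHAMBER ERROR BOUND — how far a chamber functional can be off, for ANY type

HONEST FRAMING (cell `pub-zeta5`): systematic search; no irrationality claim unless kernel-certified. MODEL objects
under Brown–Zudilin's (28)+(30) accounting ([BZ22] = arXiv:2210.03391; (28) observed, not proved); nothing here is a
statement about `ζ(5)`, any `γ` of record, the cone's supremum (C2 OPEN) or the value / sign of the cusp slope, of any
defect bound `Λ` or gauge at a named direction (DATA of the cell); S-E stays CONJECTURED; records in print UNMOVED.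
Prover P2 g31, item «ONE SET FUNCTION» (INBOX 2026-08-27), file (7): the quantitative complement of files (2)–(3) for a
period pattern function of NO pure type (the case of all four named directions, DATA).

THE DC TRICK. The cardinality pattern `p(A) = −C(|A|, 2)` has ALL local defects equal to `1` (`choose2_local_defect`),
so it is submodular on every `M` (`choose2_submodular`); if every local defect of `f` inside `M` is `≥ −Λ` then
`f + Λ·p` is submodular, if every one is `≤ Λ` then `f − Λ·p` is supermodular (`submodular_add_choose2_of_local_ge`,
`supermodular_sub_choose2_of_local_le`; the local criterion of file (6)). Reading P2 g30's Edmonds bound for these two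
functions at `M = univ` and subtracting the `p`-parts:
* **`greedy_sub_gauge_le_cuspSlope`** / **`cuspSlope_le_greedy_add_gauge`** — for ANY period pattern function `F` whose
  wall defects are bounded by `Λ` in absolute value, every generic reference `δ₀` and EVERY `δ`:
  `G_{δ₀}(δ) − Λ·D_{δ₀}(δ) ≤ σ(δ) ≤ G_{δ₀}(δ) + Λ·D_{δ₀}(δ)`, with the UNIVERSAL GAUGE (no `F`, no `a` beyond the rates)
  `D_{δ₀}(δ) = p̂(δ) − G^p_{δ₀}(δ)` = (Choquet value of `p` along the flip times of `δ`) − (greedy functional of `p` in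
  the order of `δ₀`, at `δ`);
* `gauge_nonneg` (`D ≥ 0`, Edmonds for `p`), `gauge_eq_zero_of_refines` (`D = 0` on the closed chamber of `δ₀` — there
  the bound is the identity of file (1)).
So a chamber functional mis-predicts `σ` off its chamber by at most `Λ ×` a fixed piecewise-linear gauge vanishing on
the chamber: the kernel lemma behind any CONE-COVERING certification of «σ ≤ 0 in every direction» in the non-typed
case (the covering itself is a kit-sized computation, NOT done or authorised here). NOT here: `Λ` or `D` at any named
direction; the closed form `D_{δ₀}(δ) = Σ_{pairs inverted between δ₀ and δ} |r_k(δ) − r_l(δ)|` (desk-checked, not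
proved); `γ`, C2, S-E, `ζ(5)`.
-/

noncomputable section

open Set MeasureTheory Finset
open scoped Topology

namespace Summit.KontsevichZagierPeriods.Zeta5Search.Barrier.ConeGamma

/-! ### The cardinality pattern `−C(|A|,2)`: all local defects equal `1` -/

/-- **`p(A) = −C(|A|,2)` has every local defect equal to `1`**: for `k ≠ l ∉ S`,
`p(S∪{k}) + p(S∪{l}) − p(S) − p(S∪{k,l}) = 1` (`C(s+2,2) − 2C(s+1,2) + C(s,2) = 1`). -/
theorem choose2_local_defect {p : Finset (Fin 28) → ℝ} (hp : ∀ A, p A = -((A.card.choose 2 : ℕ) : ℝ))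
    {S : Finset (Fin 28)} {k l : Fin 28} (hkS : k ∉ S) (hlS : l ∉ S) (hkl : k ≠ l) :
    p (insert k S) + p (insert l S) - p S - p (insert k (insert l S)) = 1 := by
  have hk' : k ∉ insert l S := fun h => by
    rcases Finset.mem_insert.mp h with h | h
    · exact hkl h
    · exact hkS h
  rw [hp, hp, hp, hp, Finset.card_insert_of_notMem hkS, Finset.card_insert_of_notMem hlS,
    Finset.card_insert_of_notMem hk', Finset.card_insert_of_notMem hlS]
  have h1 : (S.card + 1).choose 2 = S.card + S.card.choose 2 := by
    rw [Nat.choose_succ_succ, Nat.choose_one_right]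
  have h2 : (S.card + 1 + 1).choose 2 = (S.card + 1) + (S.card + S.card.choose 2) := by
    rw [Nat.choose_succ_succ, Nat.choose_one_right, h1]
  rw [h1, h2]
  push_cast
  ring

/-- **`p(A) = −C(|A|,2)` is submodular** on the subsets of every `M` (local criterion, defects `= 1 ≥ 0`). -/
theorem choose2_submodular {p : Finset (Fin 28) → ℝ} (hp : ∀ A, p A = -((A.card.choose 2 : ℕ) : ℝ))
    (M : Finset (Fin 28)) :
    ∀ A B : Finset (Fin 28), A ⊆ M → B ⊆ M → p (A ∪ B) + p (A ∩ B) ≤ p A + p B :=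
  submodular_of_local_nonneg fun S _ k _ l _ hkS hlS hkl => by
    linarith [choose2_local_defect hp hkS hlS hkl (S := S)]

/-- **DC, lower side**: if every local defect of `f` inside `M` is `≥ −Λ`, then `f + Λ·p` is submodular on the subsets
of `M`. -/
theorem submodular_add_choose2_of_local_ge {M : Finset (Fin 28)} {f p : Finset (Fin 28) → ℝ}
    (hp : ∀ A, p A = -((A.card.choose 2 : ℕ) : ℝ)) {Λ : ℝ}
    (hdef : ∀ S, S ⊆ M → ∀ k ∈ M, ∀ l ∈ M, k ∉ S → l ∉ S → k ≠ l →
      -Λ ≤ f (insert k S) + f (insert l S) - f S - f (insert k (insert l S))) :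
    ∀ A B : Finset (Fin 28), A ⊆ M → B ⊆ M →
      (f (A ∪ B) + Λ * p (A ∪ B)) + (f (A ∩ B) + Λ * p (A ∩ B)) ≤ (f A + Λ * p A) + (f B + Λ * p B) :=
  submodular_of_local_nonneg (f := fun X => f X + Λ * p X) fun S hS k hk l hl hkS hlS hkl => by
    have h1 := hdef S hS k hk l hl hkS hlS hkl
    have h2 := choose2_local_defect hp hkS hlS hkl (S := S)
    have h3 : Λ * p (insert k S) + Λ * p (insert l S) - Λ * p S - Λ * p (insert k (insert l S)) = Λ := by
      rw [← mul_add, ← mul_sub, ← mul_sub, h2, mul_one]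
    linarith

/-- **DC, upper side**: if every local defect of `f` inside `M` is `≤ Λ`, then `f − Λ·p` is supermodular on the
subsets of `M`. -/
theorem supermodular_sub_choose2_of_local_le {M : Finset (Fin 28)} {f p : Finset (Fin 28) → ℝ}
    (hp : ∀ A, p A = -((A.card.choose 2 : ℕ) : ℝ)) {Λ : ℝ}
    (hdef : ∀ S, S ⊆ M → ∀ k ∈ M, ∀ l ∈ M, k ∉ S → l ∉ S → k ≠ l →
      f (insert k S) + f (insert l S) - f S - f (insert k (insert l S)) ≤ Λ) :
    ∀ A B : Finset (Fin 28), A ⊆ M → B ⊆ M →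
      (f A - Λ * p A) + (f B - Λ * p B) ≤ (f (A ∪ B) - Λ * p (A ∪ B)) + (f (A ∩ B) - Λ * p (A ∩ B)) :=
  supermodular_of_local_nonpos (f := fun X => f X - Λ * p X) fun S hS k hk l hl hkS hlS hkl => by
    have h1 := hdef S hS k hk l hl hkS hlS hkl
    have h2 := choose2_local_defect hp hkS hlS hkl (S := S)
    have h3 : Λ * p (insert k S) + Λ * p (insert l S) - Λ * p S - Λ * p (insert k (insert l S)) = Λ := by
      rw [← mul_add, ← mul_sub, ← mul_sub, h2, mul_one]
    linarith

/-! ### The universal gauge: non-negative, zero on the closed chamber -/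

/-- **THE GAUGE IS NON-NEGATIVE.** For rates `ρ` pairwise distinct on all 28 forms, flip times `c` and a strict chain
`d_0 < ⋯ < d_n` through them at interior indices: the Choquet value of `p = −C(|·|,2)` along `c` dominates the greedy
functional of `p` in the order of `ρ` at `−c`: `Σ_k (p(P≤(k)) − p(P<(k)))·(−c_k) ≤ −Σ_i d_i (p(S_i) − p(S_{i−1}))`
(Edmonds for the submodular `p`). -/
theorem gauge_nonneg {p : Finset (Fin 28) → ℝ} (hp : ∀ A, p A = -((A.card.choose 2 : ℕ) : ℝ)) {ρ : Fin 28 → ℝ}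
    (hgen : ∀ k l : Fin 28, k ≠ l → ρ k ≠ ρ l) (c : Fin 28 → ℝ) {n : ℕ} {d : ℕ → ℝ}
    (hmono : ∀ j < n, d j < d (j + 1)) (hflip : ∀ k, ∃ i, 0 < i ∧ i < n ∧ d i = c k) :
    ∑ k, (p (Finset.univ.filter fun l => ρ k ≤ ρ l) - p (Finset.univ.filter fun l => ρ k < ρ l)) * (-c k) ≤
      -∑ i ∈ Finset.Ico 1 n, d i *
        (p (Finset.univ.filter fun k => c k ≤ d i) - p (Finset.univ.filter fun k => c k ≤ d (i - 1))) :=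
  greedy_le_lovasz_of_submodular (M := Finset.univ) (fun k _ l _ hkl => hgen k l hkl)
    (choose2_submodular hp Finset.univ) c hmono (fun k _ => hflip k)

/-- **THE GAUGE VANISHES ON THE CLOSED CHAMBER**: if every threshold set of `c` is empty or a prefix set of `ρ` (the
order of `c` refined by the order of `ρ`), the two sides of `gauge_nonneg` are EQUAL (any `p`, in particular ours). -/
theorem gauge_eq_zero_of_prefix (p : Finset (Fin 28) → ℝ) {ρ : Fin 28 → ℝ}
    (hgen : ∀ k l : Fin 28, k ≠ l → ρ k ≠ ρ l) (c : Fin 28 → ℝ) {n : ℕ} {d : ℕ → ℝ}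
    (hmono : ∀ j < n, d j < d (j + 1)) (hflip : ∀ k, ∃ i, 0 < i ∧ i < n ∧ d i = c k)
    (hprefix : ∀ i < n, Finset.univ.filter (fun k => c k ≤ d i) = ∅ ∨
      ∃ t, Finset.univ.filter (fun k => c k ≤ d i) = Finset.univ.filter fun l => ρ t ≤ ρ l) :
    ∑ k, (p (Finset.univ.filter fun l => ρ k ≤ ρ l) - p (Finset.univ.filter fun l => ρ k < ρ l)) * (-c k) =
      -∑ i ∈ Finset.Ico 1 n, d i *
        (p (Finset.univ.filter fun k => c k ≤ d i) - p (Finset.univ.filter fun k => c k ≤ d (i - 1))) :=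
  greedy_eq_lovasz_of_prefix (M := Finset.univ) p (fun k _ l _ hkl => hgen k l hkl) c hmono (fun k _ => hflip k)
    (fun i hi => (hprefix i hi).imp id fun ⟨t, ht⟩ => ⟨t, Finset.mem_univ _, ht⟩)

/-! ### The off-chamber error bound for the cusp slope -/

/-- **OFF-CHAMBER ERROR BOUND, LOWER SIDE.** With the data of `cuspSlope_eq_lovasz_period`, `p(A) = −C(|A|,2)` and a
bound `Λ` with `−Λ ≤` every wall defect of `F` (behind every prefix, at every pair): for every generic reference `δ₀`,
every displacement `δ` and every strict chain `d` through the 28 flip times `c_k = −φ_k(δ)/h_k(a)` (interior indices):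
`G^F_{δ₀}(δ) − Λ·D ≤ cuspSlope a T δ`, where `G^F_{δ₀}(δ) = Σ_k (F(P≤(k)) − F(P<(k)))·φ_k(δ)/h_k` is the chamber
functional and `D = [−Σ_i d_i (p(S_i) − p(S_{i−1}))] − [Σ_k (p(P≤(k)) − p(P<(k)))·φ_k(δ)/h_k] ≥ 0` the universal gauge. -/
theorem greedy_sub_gauge_le_cuspSlope {a : Dir} (hpos : ∀ k, 0 < h28 a k) {T : ℝ} (hT : 0 < T)
    (hper : ∀ k : Fin 28, ∃ z : ℤ, T * h28 a k = z)
    {M : ℕ → Finset (Fin 28)} {f : ℕ → Finset (Fin 28) → ℝ}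
    (hf : ∀ m, m + 1 < (bkpts a T).card → ∀ Δ : Fin 8 → ℝ, (∀ k, |phiForm Δ k| < 1) →
      (∀ k, |phiForm Δ k| < wallDist a T) →
        (torusN (bkpt a T m • sParam a + Δ) : ℝ) = f m ((M m).filter fun k => 0 ≤ phiForm Δ k))
    {F : Finset (Fin 28) → ℝ} (hF : ∀ A, F A = ∑ m ∈ Finset.range ((bkpts a T).card - 1), f m (A ∩ M m))
    {p : Finset (Fin 28) → ℝ} (hp : ∀ A, p A = -((A.card.choose 2 : ℕ) : ℝ)) {Λ : ℝ}
    (hdef : ∀ S : Finset (Fin 28), ∀ k l : Fin 28, k ∉ S → l ∉ S → k ≠ l →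
      -Λ ≤ F (insert k S) + F (insert l S) - F S - F (insert k (insert l S)))
    {δ₀ : Fin 8 → ℝ} (hgen : ∀ k l : Fin 28, k ≠ l → phiForm δ₀ k / h28 a k ≠ phiForm δ₀ l / h28 a l)
    (δ : Fin 8 → ℝ) {n : ℕ} {d : ℕ → ℝ} (hd0 : d 0 = -clusterWidth a δ) (hdn : d n = clusterWidth a δ)
    (hmono : ∀ j < n, d j < d (j + 1))
    (hflip : ∀ k, ∃ i, 0 < i ∧ i < n ∧ d i = -(phiForm δ k / h28 a k)) :
    ∑ k, (F (Finset.univ.filter fun l => phiForm δ₀ k / h28 a k ≤ phiForm δ₀ l / h28 a l) -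
        F (Finset.univ.filter fun l => phiForm δ₀ k / h28 a k < phiForm δ₀ l / h28 a l)) * (phiForm δ k / h28 a k) -
      Λ * (-(∑ i ∈ Finset.Ico 1 n, d i *
          (p (Finset.univ.filter fun k => -(phiForm δ k / h28 a k) ≤ d i) -
            p (Finset.univ.filter fun k => -(phiForm δ k / h28 a k) ≤ d (i - 1)))) -
        ∑ k, (p (Finset.univ.filter fun l => phiForm δ₀ k / h28 a k ≤ phiForm δ₀ l / h28 a l) -
          p (Finset.univ.filter fun l => phiForm δ₀ k / h28 a k < phiForm δ₀ l / h28 a l)) * (phiForm δ k / h28 a k))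
      ≤ cuspSlope a T δ := by
  classical
  have hflip' : ∀ k, ∃ i ≤ n, d i = -(phiForm δ k / h28 a k) := fun k => by
    obtain ⟨i, -, hin, hdi⟩ := hflip k; exact ⟨i, hin.le, hdi⟩
  have hσ := cuspSlope_eq_lovasz_period hpos hT hper hf hF δ hd0 hdn (fun j hj => (hmono j hj).le) hflip'
  -- Edmonds for the submodular `F + Λ p` at `M = univ`
  have hsubg := submodular_add_choose2_of_local_ge (M := Finset.univ) (f := F) hp (Λ := Λ)
    (fun S _ k _ l _ hkS hlS hkl => hdef S k l hkS hlS hkl)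
  have key := greedy_le_lovasz_of_submodular (M := Finset.univ) (ρ := fun k => phiForm δ₀ k / h28 a k)
    (f := fun X => F X + Λ * p X) (fun k _ l _ hkl => hgen k l hkl) hsubg
    (fun k => -(phiForm δ k / h28 a k)) hmono (fun k _ => hflip k)
  simp only [neg_neg] at key
  -- split both sides into their `F`- and `p`-parts
  have eL : ∑ k, (F (Finset.univ.filter fun l => phiForm δ₀ k / h28 a k ≤ phiForm δ₀ l / h28 a l) +
        Λ * p (Finset.univ.filter fun l => phiForm δ₀ k / h28 a k ≤ phiForm δ₀ l / h28 a l) -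
        (F (Finset.univ.filter fun l => phiForm δ₀ k / h28 a k < phiForm δ₀ l / h28 a l) +
          Λ * p (Finset.univ.filter fun l => phiForm δ₀ k / h28 a k < phiForm δ₀ l / h28 a l))) *
        (phiForm δ k / h28 a k) =
      ∑ k, (F (Finset.univ.filter fun l => phiForm δ₀ k / h28 a k ≤ phiForm δ₀ l / h28 a l) -
          F (Finset.univ.filter fun l => phiForm δ₀ k / h28 a k < phiForm δ₀ l / h28 a l)) * (phiForm δ k / h28 a k) +
      Λ * ∑ k, (p (Finset.univ.filter fun l => phiForm δ₀ k / h28 a k ≤ phiForm δ₀ l / h28 a l) -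
          p (Finset.univ.filter fun l => phiForm δ₀ k / h28 a k < phiForm δ₀ l / h28 a l)) * (phiForm δ k / h28 a k) := by
    rw [Finset.mul_sum, ← Finset.sum_add_distrib]
    exact Finset.sum_congr rfl fun k _ => by ring
  have eR : ∑ i ∈ Finset.Ico 1 n, d i *
        (F (Finset.univ.filter fun k => -(phiForm δ k / h28 a k) ≤ d i) +
          Λ * p (Finset.univ.filter fun k => -(phiForm δ k / h28 a k) ≤ d i) -
          (F (Finset.univ.filter fun k => -(phiForm δ k / h28 a k) ≤ d (i - 1)) +
            Λ * p (Finset.univ.filter fun k => -(phiForm δ k / h28 a k) ≤ d (i - 1)))) =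
      ∑ i ∈ Finset.Ico 1 n, d i *
        (F (Finset.univ.filter fun k => -(phiForm δ k / h28 a k) ≤ d i) -
          F (Finset.univ.filter fun k => -(phiForm δ k / h28 a k) ≤ d (i - 1))) +
      Λ * ∑ i ∈ Finset.Ico 1 n, d i *
        (p (Finset.univ.filter fun k => -(phiForm δ k / h28 a k) ≤ d i) -
          p (Finset.univ.filter fun k => -(phiForm δ k / h28 a k) ≤ d (i - 1))) := by
    rw [Finset.mul_sum, ← Finset.sum_add_distrib]
    exact Finset.sum_congr rfl fun i _ => by ring
  rw [eL, eR] at key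
  rw [hσ]
  linarith

/-- **OFF-CHAMBER ERROR BOUND, UPPER SIDE.** Under the same data with every wall defect of `F` `≤ Λ`:
`cuspSlope a T δ ≤ G^F_{δ₀}(δ) + Λ·D`. Together with the lower side: `|σ(δ) − G^F_{δ₀}(δ)| ≤ Λ·D_{δ₀}(δ)` for a
period pattern function of ANY type — each chamber functional mis-predicts the cusp slope off its chamber by at most
the largest wall defect times a universal gauge vanishing on the chamber. -/
theorem cuspSlope_le_greedy_add_gauge {a : Dir} (hpos : ∀ k, 0 < h28 a k) {T : ℝ} (hT : 0 < T)
    (hper : ∀ k : Fin 28, ∃ z : ℤ, T * h28 a k = z)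
    {M : ℕ → Finset (Fin 28)} {f : ℕ → Finset (Fin 28) → ℝ}
    (hf : ∀ m, m + 1 < (bkpts a T).card → ∀ Δ : Fin 8 → ℝ, (∀ k, |phiForm Δ k| < 1) →
      (∀ k, |phiForm Δ k| < wallDist a T) →
        (torusN (bkpt a T m • sParam a + Δ) : ℝ) = f m ((M m).filter fun k => 0 ≤ phiForm Δ k))
    {F : Finset (Fin 28) → ℝ} (hF : ∀ A, F A = ∑ m ∈ Finset.range ((bkpts a T).card - 1), f m (A ∩ M m))
    {p : Finset (Fin 28) → ℝ} (hp : ∀ A, p A = -((A.card.choose 2 : ℕ) : ℝ)) {Λ : ℝ}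
    (hdef : ∀ S : Finset (Fin 28), ∀ k l : Fin 28, k ∉ S → l ∉ S → k ≠ l →
      F (insert k S) + F (insert l S) - F S - F (insert k (insert l S)) ≤ Λ)
    {δ₀ : Fin 8 → ℝ} (hgen : ∀ k l : Fin 28, k ≠ l → phiForm δ₀ k / h28 a k ≠ phiForm δ₀ l / h28 a l)
    (δ : Fin 8 → ℝ) {n : ℕ} {d : ℕ → ℝ} (hd0 : d 0 = -clusterWidth a δ) (hdn : d n = clusterWidth a δ)
    (hmono : ∀ j < n, d j < d (j + 1))
    (hflip : ∀ k, ∃ i, 0 < i ∧ i < n ∧ d i = -(phiForm δ k / h28 a k)) :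
    cuspSlope a T δ ≤
      ∑ k, (F (Finset.univ.filter fun l => phiForm δ₀ k / h28 a k ≤ phiForm δ₀ l / h28 a l) -
        F (Finset.univ.filter fun l => phiForm δ₀ k / h28 a k < phiForm δ₀ l / h28 a l)) * (phiForm δ k / h28 a k) +
      Λ * (-(∑ i ∈ Finset.Ico 1 n, d i *
          (p (Finset.univ.filter fun k => -(phiForm δ k / h28 a k) ≤ d i) -
            p (Finset.univ.filter fun k => -(phiForm δ k / h28 a k) ≤ d (i - 1)))) -
        ∑ k, (p (Finset.univ.filter fun l => phiForm δ₀ k / h28 a k ≤ phiForm δ₀ l / h28 a l) -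
          p (Finset.univ.filter fun l => phiForm δ₀ k / h28 a k < phiForm δ₀ l / h28 a l)) *
          (phiForm δ k / h28 a k)) := by
  classical
  have hflip' : ∀ k, ∃ i ≤ n, d i = -(phiForm δ k / h28 a k) := fun k => by
    obtain ⟨i, -, hin, hdi⟩ := hflip k; exact ⟨i, hin.le, hdi⟩
  have hσ := cuspSlope_eq_lovasz_period hpos hT hper hf hF δ hd0 hdn (fun j hj => (hmono j hj).le) hflip'
  have hsupg := supermodular_sub_choose2_of_local_le (M := Finset.univ) (f := F) hp (Λ := Λ)
    (fun S _ k _ l _ hkS hlS hkl => hdef S k l hkS hlS hkl)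
  have key := lovasz_le_greedy_of_supermodular (M := Finset.univ) (ρ := fun k => phiForm δ₀ k / h28 a k)
    (f := fun X => F X - Λ * p X) (fun k _ l _ hkl => hgen k l hkl) hsupg
    (fun k => -(phiForm δ k / h28 a k)) hmono (fun k _ => hflip k)
  simp only [neg_neg] at key
  have eL : ∑ k, (F (Finset.univ.filter fun l => phiForm δ₀ k / h28 a k ≤ phiForm δ₀ l / h28 a l) -
        Λ * p (Finset.univ.filter fun l => phiForm δ₀ k / h28 a k ≤ phiForm δ₀ l / h28 a l) -
        (F (Finset.univ.filter fun l => phiForm δ₀ k / h28 a k < phiForm δ₀ l / h28 a l) -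
          Λ * p (Finset.univ.filter fun l => phiForm δ₀ k / h28 a k < phiForm δ₀ l / h28 a l))) *
        (phiForm δ k / h28 a k) =
      ∑ k, (F (Finset.univ.filter fun l => phiForm δ₀ k / h28 a k ≤ phiForm δ₀ l / h28 a l) -
          F (Finset.univ.filter fun l => phiForm δ₀ k / h28 a k < phiForm δ₀ l / h28 a l)) * (phiForm δ k / h28 a k) -
      Λ * ∑ k, (p (Finset.univ.filter fun l => phiForm δ₀ k / h28 a k ≤ phiForm δ₀ l / h28 a l) -
          p (Finset.univ.filter fun l => phiForm δ₀ k / h28 a k < phiForm δ₀ l / h28 a l)) * (phiForm δ k / h28 a k) := by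
    rw [Finset.mul_sum, ← Finset.sum_sub_distrib]
    exact Finset.sum_congr rfl fun k _ => by ring
  have eR : ∑ i ∈ Finset.Ico 1 n, d i *
        (F (Finset.univ.filter fun k => -(phiForm δ k / h28 a k) ≤ d i) -
          Λ * p (Finset.univ.filter fun k => -(phiForm δ k / h28 a k) ≤ d i) -
          (F (Finset.univ.filter fun k => -(phiForm δ k / h28 a k) ≤ d (i - 1)) -
            Λ * p (Finset.univ.filter fun k => -(phiForm δ k / h28 a k) ≤ d (i - 1)))) =
      ∑ i ∈ Finset.Ico 1 n, d i *
        (F (Finset.univ.filter fun k => -(phiForm δ k / h28 a k) ≤ d i) -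
          F (Finset.univ.filter fun k => -(phiForm δ k / h28 a k) ≤ d (i - 1))) -
      Λ * ∑ i ∈ Finset.Ico 1 n, d i *
        (p (Finset.univ.filter fun k => -(phiForm δ k / h28 a k) ≤ d i) -
          p (Finset.univ.filter fun k => -(phiForm δ k / h28 a k) ≤ d (i - 1))) := by
    rw [Finset.mul_sum, ← Finset.sum_sub_distrib]
    exact Finset.sum_congr rfl fun i _ => by ring
  rw [eL, eR] at key
  rw [hσ]
  linarith

/-- **A STRICT CHAIN THROUGH THE 28 FLIP TIMES EXISTS** (so the two bounds above are never vacuous): for every `δ` there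
are `n` and `d` with `d_0 = −W`, `d_n = W`, `d` strictly increasing, every flip time `−φ_k(δ)/h_k(a)` an interior
chain point (P2 g30's `exists_member_chain` at `M = univ`). -/
theorem exists_flip_chain {a : Dir} (hpos : ∀ k, 0 < h28 a k) (δ : Fin 8 → ℝ) :
    ∃ (n : ℕ) (d : ℕ → ℝ), d 0 = -clusterWidth a δ ∧ d n = clusterWidth a δ ∧ (∀ j < n, d j < d (j + 1)) ∧
      ∀ k, ∃ i, 0 < i ∧ i < n ∧ d i = -(phiForm δ k / h28 a k) := by
  obtain ⟨n, d, hd0, hdn, hmono, -, hflipM⟩ := exists_member_chain hpos 0 Finset.univ δ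
  exact ⟨n, d, hd0, hdn, hmono, fun k => hflipM k (Finset.mem_univ k)⟩

end Summit.KontsevichZagierPeriods.Zeta5Search.Barrier.ConeGamma

end
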